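import Summits.HodgeConjecture.HodgeConjecture.Theorems.K2E3KeysThmTwoDepthZeroBranchBInert            -- ★ p862200∕p862201 (K2E3-p32 (g0)): `exists_eta_of_reducible_of_shellIdentities` — :155 at an inert place MODULO the shell letters, (G3)-frame in the binders
import Summits.HodgeConjecture.HodgeConjecture.Theorems.K2E3BranchBShellScalingFromWeightSeries     -- ★ p862287 (K2E3-p06 (g5)): (II)-a letters (a) `integrableOn_F₀_S_ge` = `hint`, (b) `integral_S_ge_eq` = `hscal`
import Summits.HodgeConjecture.HodgeConjecture.Theorems.K2E3BranchBSkewUnitSign                     -- ★ p862070 (K2E3-p03 (g9)): (II)-b1 `coe_apply_skew_unit_sq` (`ε₀² = 1`, `ε₀ = χ₁(δ₀)`)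
import Summits.HodgeConjecture.HodgeConjecture.Theorems.K2E3BranchBSkewUnitExists                   -- ★∕📤 (this seat, (W-1)): `exists_skew_unit_valued_eq_one` — the frame letter `δ₀ hδσ hδv` discharged
import HarnessLib

/-!
# K2 ∕ E3 «EllipticInputs», unit U4 «Keys» — (U4f-χ₁-ram-one-d0B) THE SOCKET :155 AT AN INERT PLACE, FRAME-FREE, MODULO EXACTLY THE TWO SHELL VALUES `∫_{Sh 1} F₀` AND `∫_{Sh 0} F₀`
# `i(χ₁, 1)` reducible (χ₁ continuous, non-unitary, contracting, depth zero, Branch B; `v` non-split, unramified in `L`) ⟹ `χ₁ = η · ‖·‖^{1∕2}`, `η` a quadratic character extension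
# [Keys1984 §3, §7 Thm (2); Casselman1980 §3; Casselman1995 §6.4, Thm. 6.6.2; Rogawski1990 §12.1–§12.2; Roche1998 §3–§4]

Cell `pub/hodgecm-mathlib` (D-0151), crux H413 = `stmt-HodgeConjecture-24833`, route of record `HCCMUnconditional`; chair K2-lead (g2) (LEAD hat pro tem), LINE-LEAD∕dealer K2E3-plan
(g5), cell «U4-RAM» (Z3-c frame v1 `K2/K2E3-p03/g9/Z3c-frame.v1.txt`, K2E3-p03 (g9)).  Typed by the S1 hand R90-C10-p04 (g0) («continue the (II)-b3 support with K2E3-p03 as you two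
agree», chair VALVE 2026-09-04T21:51Z∕21:53Z; K2E3-p03 (g9) «=» 21:59:37Z: «the closing wrapper + SkewUnitExists are yours; H-binder order fine»).  THEOREMS ONLY (no `def`, no
`instance`, no notation, no named-fact hypothesis, no `sorry`); lane `--supports stmt-HodgeConjecture-24833 --as helper`, count-neutral.  NOT THE PAYER: the two shell VALUES
`H1` (shell one, (II)-a (c) `K2E3BranchBShellOneInert`, K2E3-p06 (g5)) and `H0` (shell zero, (II)-b3 `K2E3BranchBShellZero`, K2E3-p03 (g9)) remain hypotheses — ∀-CLOSED over the frame
letters `(w) (δ₀) (hδσ) (hδv)` and over every Borel σ-algebra ∕ Haar measure of `N(L⁺_v)`, in EXACTLY the binder shapes `h1` ∕ `h0` of ★ `…BranchBInert.exists_eta_of_reducible_of_shellIdentities`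
with `ε₀ := ((χ₁ δ₀ : ℂˣ) : ℂ)`; dyadic-inert and ramified places are separate theorems (the wrapper itself carries NO parity hypothesis — parity enters only through the payers of `H0`∕`H1`).

THE POINT.  ★ p862200∕p862201 (K2E3-p32 (g0)) reduced :155 at an inert place to five letters `hint hscal h1 h0 hε` over the (G3)-EXPLICIT frame `(w hw eA heA ϖ hϖ g₁ hg₁ K0 K1 I hK0 hK1 hI
w₀ hw₀ μ)`.  This module DISCHARGES everything but the two shell values: the frame exactly as ★ Z2A-6 `K2E3BranchAIrreducibleDepthZeroLeaf` builds it (a uniformiser `ϖ`, `g₁ = diag(1,1,ϖ)`,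
`eA =` ★ `localNonsplitEquiv` on `Φ₃`, `K0 ∕ K1 ∕ I` by `rfl`, `w₀ = eA⁻¹(w_long)` with matrix `Φ₃`), the Haar measure `Measure.haar` of the closed subgroup `N(L⁺_v)` (★ `locallyCompactSpace_local`, ★ `LineRing.isClosed_unipotentU`)
on its Borel σ-algebra, the skew unit `δ₀` (★ (W-1) `exists_skew_unit_valued_eq_one`, `v` unramified), the sign `ε₀ := χ₁(δ₀)`, `ε₀² = 1` (★ (II)-b1 `coe_apply_skew_unit_sq`), `|Y| < 1` (★
`norm_apply_uniformizer_lt_one`), `hint` (★ (II)-a `integrableOn_F₀_S_ge`) and `hscal` (★ (II)-a `integral_S_ge_eq`).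
* **`exists_eta_of_reducible_of_shellLetters`** — :155's second disjunct at an inert place from `H1`, `H0` alone.
WHEN `H1` ∕ `H0` ARE ★ (heads `integral_Sh_one` ∕ `integral_Sh_zero` in the frame-v1 letters `(L v w hw hunr h2w … χ₁ h₁ hdepth hB hram δ₀ hδσ hδv μ)`), the payer of :155 at an inert odd
place is `exists_eta_of_reducible_of_shellLetters … (fun w δ₀ hδσ hδv _ _ μ _ => integral_Sh_one …) (fun w δ₀ hδσ hδv _ _ μ _ => integral_Sh_zero …) hred` — five lines.
HONEST LABEL.  HC_CM is proved only modulo the 7 printed citations (2 remaining named inputs: hLiu418 = `stmt-HodgeConjecture-24832`, h413 = `stmt-HodgeConjecture-24833`) until rung 0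
closes; count-neutral — this file does NOT pay the leaf; no printed citation is discharged.

## References
* [Keys1984] D. Keys, *Principal series representations of special unitary groups over local fields*, Compositio Math. 51 (1984), §3, §7 Theorem (2) p. 126.
* [Casselman1980] W. Casselman, *The unramified principal series of p-adic groups I*, Compositio Math. 40 (1980), §3.
* [Casselman1995] W. Casselman, *Introduction to the theory of admissible representations of `p`-adic reductive groups* (1995), §6.4, Thm. 6.6.2.
* [Rogawski1990] J. Rogawski, *Automorphic representations of unitary groups in three variables*, Ann. of Math. Stud. 123 (1990), §12.1 p. 171, §12.2 (1)–(2) p. 173.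
* [Roche1998] A. Roche, *Types and Hecke algebras for principal series representations of split reductive p-adic groups*, Ann. Sci. ÉNS (4) 31 (1998), §3–§4.
-/

set_option autoImplicit false
-- the mandated namespace has the single-problem summit's repeated segment (`HodgeConjecture.HodgeConjecture`)
set_option linter.dupNamespace false

noncomputable section

open NumberField IsDedekindDomain MeasureTheory
open scoped Matrix MatrixGroups WithZero Valued NNReal
open Literature.NumberTheory Literature.NumberTheory.Automorphic Literature.NumberTheory.Automorphic.UnitaryGroup
open Literature.NumberTheory.Rogawski1990

namespace Summit.HodgeConjecture.HodgeConjecture.Cruxes.H413.K2E3KeysThmTwoDepthZeroBranchBInertLeaf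

open Summit.HodgeConjecture.HodgeConjecture.Cruxes.H413
open Summit.HodgeConjecture.HodgeConjecture.Cruxes.H413.K2E3DepthZeroIwahoriCharacterCM
open Summit.HodgeConjecture.HodgeConjecture.Cruxes.H413.K2E3BranchATorusWitnessCM

variable (L : Type) [Field L] [NumberField L] [IsCMField L] (v : HeightOneSpectrum (𝓞 ↥(maximalRealSubfield L)))

/-! ## :155 at an inert place, frame-free, modulo the two shell values -/

open Classical in
set_option maxHeartbeats 4000000 in
set_option synthInstance.maxHeartbeats 400000 in
-- ★ p32's closing composition instantiated: the (G3) frame (★ Z2A-6 pattern), `w₀ = eA⁻¹(w_long)`, the Haar measure of `N(L⁺_v)`, the skew unit `δ₀`, `ε₀ = χ₁(δ₀)`, and the (II)-a letters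
/-- **THE SOCKET :155 AT AN INERT PLACE, FRAME-FREE, MODULO THE TWO SHELL VALUES.**  `v` non-split and UNRAMIFIED in `L`; `χ₁ : (L ⊗ L⁺_v)ˣ → ℂˣ` continuous, non-unitary (`∃ x, |χ₁ x| ≠ 1`),
contracting, trivial on the principal units (depth zero), `χ₁(u·σu) = 1` on the units of valuation one (Branch B).  HYPOTHESES `H1`, `H0` (the shell values of PAPER-Z3 §1, for EVERY place
`w ∣ v`, EVERY skew unit `δ₀` with `|(δ₀)_w| = 1`, EVERY Borel σ-algebra and Haar measure `μ` of `N(L⁺_v)`, on the frame-v1 integrand `F₀(n) = χ₁((σz)⁻¹)·‖z‖⁻¹`, `z = n₀₂`, `0` off the units):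
`∫_{|z|_w = exp 1} F₀ dμ = χ₁(δ₀)·Y·((q−1)∕q²)·μ{|z|_w ≤ 1}` and `∫_{|z|_w = 1} F₀ dμ = −(χ₁(δ₀)·((q−1)∕q²)·μ{|z|_w ≤ 1})` (`Y = χ₁(ϖ̂)`, `q = N𝔭_v`).  If `i(χ₁, 1)` is reducible then
**`χ₁ = η · ‖·‖^{1∕2}` for a continuous quadratic character extension `η`** — the second disjunct of :155.  Proof: the (G3)-explicit frame of ★ Z2A-6 (uniformiser, `g₁ = diag(1,1,ϖ)`,
`eA =` ★ `localNonsplitEquiv`, `w₀ = eA⁻¹(w_long)` with matrix `Φ₃`), `μ := Measure.haar` on the Borel σ-algebra of `N(L⁺_v)`, `δ₀` ★ `exists_skew_unit_valued_eq_one`, `ε₀² = 1` ★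
`coe_apply_skew_unit_sq`, `|Y| < 1` ★ `norm_apply_uniformizer_lt_one`, `hint` ∕ `hscal` ★ (II)-a, then ★ `exists_eta_of_reducible_of_shellIdentities`.
[cite: Keys1984, §3, §7 Theorem (2) p. 126] [cite: Casselman1980, §3] [cite: Casselman1995, §6.4, Thm. 6.6.2] [cite: Rogawski1990, §12.2 (1)–(2) p. 173] [cite: Roche1998, §3–§4] -/
theorem exists_eta_of_reducible_of_shellLetters
    (hns : ∀ w' : PlacesOver L v, IsCMField.complexConj L • w'.1 = w'.1) (hunr : Algebra.IsUnramifiedIn (𝓞 L) v.asIdeal)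
    (χ₁ : (LocalRing L v)ˣ →* ℂˣ) (h₁ : Continuous fun x => ((χ₁ x : ℂˣ) : ℂ)) (hnu : ∃ x, ‖((χ₁ x : ℂˣ) : ℂ)‖ ≠ 1)
    (hcontr : ∀ x : (LocalRing L v)ˣ, unitModulusChar (LocalRing L v) x < 1 → ‖((χ₁ x : ℂˣ) : ℂ)‖ < 1)
    (hdepth : ∀ u : (LocalRing L v)ˣ, (∀ w' : PlacesOver L v, Valued.v (((u : LocalRing L v) w') - 1) < 1) → χ₁ u = 1)
    (hB : ∀ u : (LocalRing L v)ˣ, (∀ w' : PlacesOver L v, Valued.v ((u : LocalRing L v) w') = 1) →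
      χ₁ (u * Units.map (conjLocal L (IsCMField.complexConj L) v : LocalRing L v →* LocalRing L v) u) = 1)
    (H1 : ∀ (w : PlacesOver L v) (δ₀ : (LocalRing L v)ˣ), conjLocal L (IsCMField.complexConj L) v (δ₀ : LocalRing L v) = -(δ₀ : LocalRing L v) →
      Valued.v ((δ₀ : LocalRing L v) w) = 1 →
      ∀ [MeasurableSpace ↥(cmBorelTriple L 3 v).N] [BorelSpace ↥(cmBorelTriple L 3 v).N] (μ : Measure ↥(cmBorelTriple L 3 v).N) [μ.IsHaarMeasure],
      ∫ n in {m : ↥(cmBorelTriple L 3 v).N | Valued.v (((((m : ↥(unitaryGroupOfForm (conjLocal L (IsCMField.complexConj L) v) (cmLocalForm L 3 v))) : GL (Fin 3) (LocalRing L v)) : Matrix (Fin 3) (Fin 3) (LocalRing L v)) 0 2) w) = WithZero.exp (1 : ℤ)}, (fun n : ↥(cmBorelTriple L 3 v).N =>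
        if h : IsUnit ((((n : ↥(unitaryGroupOfForm (conjLocal L (IsCMField.complexConj L) v) (cmLocalForm L 3 v))) : GL (Fin 3) (LocalRing L v)) : Matrix (Fin 3) (Fin 3) (LocalRing L v)) 0 2) then
          ((((χ₁ (Units.map ((conjLocal L (IsCMField.complexConj L) v) : LocalRing L v →* LocalRing L v) h.unit))⁻¹ : ℂˣ) : ℂ) *
            ((((unitModulusChar (LocalRing L v) h.unit)⁻¹ : ℝ≥0) : ℝ) : ℂ))
        else 0) n ∂μ =
      ((χ₁ δ₀ : ℂˣ) : ℂ) * ((χ₁ (isUnit_toLocalRing_uniformizer L v).unit : ℂˣ) : ℂ) * ((((Ideal.absNorm v.asIdeal : ℝ) : ℂ) - 1) / ((Ideal.absNorm v.asIdeal : ℝ) : ℂ) ^ 2) * ((μ.real {m : ↥(cmBorelTriple L 3 v).N | Valued.v (((((m : ↥(unitaryGroupOfForm (conjLocal L (IsCMField.complexConj L) v) (cmLocalForm L 3 v))) : GL (Fin 3) (LocalRing L v)) : Matrix (Fin 3) (Fin 3) (LocalRing L v)) 0 2) w) ≤ 1} : ℝ) : ℂ))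
    (H0 : ∀ (w : PlacesOver L v) (δ₀ : (LocalRing L v)ˣ), conjLocal L (IsCMField.complexConj L) v (δ₀ : LocalRing L v) = -(δ₀ : LocalRing L v) →
      Valued.v ((δ₀ : LocalRing L v) w) = 1 →
      ∀ [MeasurableSpace ↥(cmBorelTriple L 3 v).N] [BorelSpace ↥(cmBorelTriple L 3 v).N] (μ : Measure ↥(cmBorelTriple L 3 v).N) [μ.IsHaarMeasure],
      ∫ n in {m : ↥(cmBorelTriple L 3 v).N | Valued.v (((((m : ↥(unitaryGroupOfForm (conjLocal L (IsCMField.complexConj L) v) (cmLocalForm L 3 v))) : GL (Fin 3) (LocalRing L v)) : Matrix (Fin 3) (Fin 3) (LocalRing L v)) 0 2) w) = 1}, (fun n : ↥(cmBorelTriple L 3 v).N =>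
        if h : IsUnit ((((n : ↥(unitaryGroupOfForm (conjLocal L (IsCMField.complexConj L) v) (cmLocalForm L 3 v))) : GL (Fin 3) (LocalRing L v)) : Matrix (Fin 3) (Fin 3) (LocalRing L v)) 0 2) then
          ((((χ₁ (Units.map ((conjLocal L (IsCMField.complexConj L) v) : LocalRing L v →* LocalRing L v) h.unit))⁻¹ : ℂˣ) : ℂ) *
            ((((unitModulusChar (LocalRing L v) h.unit)⁻¹ : ℝ≥0) : ℝ) : ℂ))
        else 0) n ∂μ = -(((χ₁ δ₀ : ℂˣ) : ℂ) * ((((Ideal.absNorm v.asIdeal : ℝ) : ℂ) - 1) / ((Ideal.absNorm v.asIdeal : ℝ) : ℂ) ^ 2) * ((μ.real {m : ↥(cmBorelTriple L 3 v).N | Valued.v (((((m : ↥(unitaryGroupOfForm (conjLocal L (IsCMField.complexConj L) v) (cmLocalForm L 3 v))) : GL (Fin 3) (LocalRing L v)) : Matrix (Fin 3) (Fin 3) (LocalRing L v)) 0 2) w) ≤ 1} : ℝ) : ℂ)))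
    (hred : ∃ N : Subrepresentation (cmPrincipalSeries L 3 v (cmTorusCharPair L v χ₁ 1)), N ≠ ⊥ ∧ N ≠ ⊤) :
    ∃ η : (LocalRing L v)ˣ →* ℂˣ, IsQuadraticCharExtension (conjLocal L (IsCMField.complexConj L) v) η ∧
      Continuous (fun x => ((η x : ℂˣ) : ℂ)) ∧ χ₁ = η * halfModulusChar (LocalRing L v) := by
  obtain ⟨w⟩ : Nonempty (PlacesOver L v) := inferInstance
  have hw : IsCMField.complexConj L • w.1 = w.1 := hns w
  -- the (G3)-EXPLICIT frame letters (★ Z2A-6 `K2E3BranchAIrreducibleDepthZeroLeaf` pattern): a uniformiser, `g₁ = diag(1,1,ϖ)`, `eA =` ★ `localNonsplitEquiv` on `Φ₃`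
  obtain ⟨ϖ, hϖ⟩ : ∃ τ : w.1.adicCompletion L, Valued.v τ = WithZero.exp (-1 : ℤ) := by
    obtain ⟨π, hπ⟩ := w.1.valuation_exists_uniformizer L
    exact ⟨(π : w.1.adicCompletion L), by rw [HeightOneSpectrum.valuedAdicCompletion_eq_valuation', hπ]⟩
  have hϖ0 : ϖ ≠ 0 := fun h0 => by rw [h0, map_zero] at hϖ; exact WithZero.zero_ne_coe hϖ
  obtain ⟨g₁, hg₁⟩ : ∃ g₁ : GL (Fin 3) (w.1.adicCompletion L), (g₁ : Matrix (Fin 3) (Fin 3) (w.1.adicCompletion L)) = Matrix.diagonal ![(1 : w.1.adicCompletion L), 1, ϖ] := by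
    refine ⟨glDiagonal 3 (w.1.adicCompletion L) ![1, 1, Units.mk0 ϖ hϖ0], ?_⟩
    rw [coe_glDiagonal]
    congr 1
    funext i
    fin_cases i <;> rfl
  have hJw : placeForm (qsForm L) w.1 = (StdForm.antidiagonal 3).over (w.1.adicCompletion L) := by
    rw [placeForm, qsForm, antidiagOne_eq_over, StdForm.over_map]
  obtain ⟨eA, heA⟩ : ∃ eA : Gqs L v ≃ₜ* ↥(unitaryGroupOfForm (galAdicCompletionMap (L := L) (IsCMField.complexConj L) hw) ((StdForm.antidiagonal 3).over (w.1.adicCompletion L))),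
      ∀ g : Gqs L v, ((eA g : ↥(unitaryGroupOfForm (galAdicCompletionMap (L := L) (IsCMField.complexConj L) hw) ((StdForm.antidiagonal 3).over (w.1.adicCompletion L)))) :
          GL (Fin 3) (w.1.adicCompletion L)) =
        ((localNonsplitEquiv (IsCMField.complexConj L) (qsForm L) (IsCMField.complexConj_ne_one L) w hw g :
          ↥(unitaryGroupOfForm (galAdicCompletionMap (L := L) (IsCMField.complexConj L) hw) (placeForm (qsForm L) w.1))) : GL (Fin 3) (w.1.adicCompletion L)) := by
    rw [← hJw]
    exact ⟨localNonsplitEquiv (IsCMField.complexConj L) (qsForm L) (IsCMField.complexConj_ne_one L) w hw, fun g => rfl⟩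
  -- `w₀ = eA⁻¹(w_long)` has matrix `Φ₃`
  have hw₀ : Units.val ((eA.symm (weylLongU (galAdicCompletionMap (L := L) (IsCMField.complexConj L) hw)
      (rfl : (StdForm.antidiagonal 3).over (w.1.adicCompletion L) = _))).val : GL (Fin 3) (LocalRing L v)) = cmLocalForm L 3 v := by
    refine Matrix.ext fun i j => ?_
    rw [LocalRing.eq_iff_apply_eq (IsCMField.complexConj L) (IsCMField.complexConj_ne_one L) w hw,
      ← coe_eA_apply L v w hw eA heA (eA.symm (weylLongU (galAdicCompletionMap (L := L) (IsCMField.complexConj L) hw) rfl)) i j,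
      ContinuousMulEquiv.apply_symm_apply, coe_coe_weylLongU, cmLocalForm_eq_over]
    have h := congr_fun (congr_fun ((StdForm.antidiagonal 3).over_map (Pi.evalRingHom (fun w' : PlacesOver L v => w'.1.adicCompletion L) w)) i) j
    rw [Matrix.map_apply, Pi.evalRingHom_apply] at h
    exact h.symm
  -- the Haar measure of the closed subgroup `N(L⁺_v)` on its Borel σ-algebra
  letI : MeasurableSpace ↥(cmBorelTriple L 3 v).N := borel _
  haveI : BorelSpace ↥(cmBorelTriple L 3 v).N := ⟨rfl⟩
  haveI : LocallyCompactSpace ↥(unitaryGroupOfForm (conjLocal L (IsCMField.complexConj L) v) (cmLocalForm L 3 v)) :=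
    locallyCompactSpace_local (IsCMField.complexConj L) 3 _ v
  haveI : LocallyCompactSpace ↥(cmBorelTriple L 3 v).N :=
    (LineRing.isClosed_unipotentU (conjLocal L (IsCMField.complexConj L) v) (cmLocalForm L 3 v)).isClosedEmbedding_subtypeVal.locallyCompactSpace
  -- the skew unit `δ₀` and the sign `ε₀ = χ₁(δ₀)`, `ε₀² = 1`
  obtain ⟨δ₀, hδσ, hδv⟩ := K2E3BranchBSkewUnitExists.exists_skew_unit_valued_eq_one L v w hunr
  have hε : ((χ₁ δ₀ : ℂˣ) : ℂ) ^ 2 = 1 := K2E3BranchBSkewUnitSign.coe_apply_skew_unit_sq L v w hw hunr χ₁ hB δ₀ hδσ hδv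
  -- the (II)-a letters `hint`, `hscal` (`|Y| < 1` by contraction)
  have hY := K2E3KeysThmTwoDepthZeroBranchBConstants.norm_apply_uniformizer_lt_one L v w hw hunr χ₁ hcontr
  have hint := K2E3BranchBShellScalingFromWeightSeries.integrableOn_F₀_S_ge L v w hw hns χ₁ h₁ hcontr (Measure.haar : Measure ↥(cmBorelTriple L 3 v).N)
  have hscal := K2E3BranchBShellScalingFromWeightSeries.integral_S_ge_eq L v w hw hns hunr χ₁ (Measure.haar : Measure ↥(cmBorelTriple L 3 v).N) hY hint
  -- the two shell values at this frame
  have h1 := H1 w δ₀ hδσ hδv (Measure.haar : Measure ↥(cmBorelTriple L 3 v).N)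
  have h0 := H0 w δ₀ hδσ hδv (Measure.haar : Measure ↥(cmBorelTriple L 3 v).N)
  exact K2E3KeysThmTwoDepthZeroBranchBInert.exists_eta_of_reducible_of_shellIdentities L v w hw eA heA hϖ g₁ hg₁ _ _ _ rfl rfl rfl
    (eA.symm (weylLongU (galAdicCompletionMap (L := L) (IsCMField.complexConj L) hw) (rfl : (StdForm.antidiagonal 3).over (w.1.adicCompletion L) = _)))
    hw₀ hns hunr χ₁ h₁ hnu hcontr hdepth hB Measure.haar hint _ hε hscal h1 h0 hred

end Summit.HodgeConjecture.HodgeConjecture.Cruxes.H413.K2E3KeysThmTwoDepthZeroBranchBInertLeaf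

end
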